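import Summits.QuantumFields.BalabanUV.Beta.EriceFlowEnclosureGevreyComposition

/-!
# Beta / EriceFlowEnclosureGevreyCompositionLetters — SERVICE: the LETTERS of a composition are Gevrey-1 — `|[X^n](mk b)^j| ≤ L^j·(2E)^n·n!`
# for b₀ = 0, |b_k| ≤ L·E^k·k! (`coeff_pow_abs_le`), hence `|Σ_{j≤n} c_j·[X^n](mk b)^j| ≤ M·(4E·max(1, L∕ρ))^n·n!` for |c_j| ≤ M∕ρ^j
# (`compLetters_abs_le`) — the SERIES-level half of MODULE 33 (Loday-Richaud Prop. 1.2.4: Gevrey-1 series are stable under composition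
# with convergent ones), with NO smallness of L∕ρ (bflow-p3 gen 37; MODULE 33b over 33 `EriceFlowEnclosureGevreyComposition` §1 BY NAME)

WHAT.  MODULE 33 `gevrey_comp` gives the pointwise Gevrey-1 EXPANSION of φ(g z) with letters ℓ_n = Σ_{j≤n} c_j·[X^n](mk b)^j.  To feed
φ∘g as the FIRST factor of 32l `gevrey_mul` or as the inner function of another `gevrey_comp` one also needs |ℓ_n| ≤ L′·E′^n·n!.
32l `letters_gevrey` recovers such a bound from the expansion at one point z ≠ 0 (constants depending on z); this file gives the
point-free majorant:
  * `sum_half_pow_le_one` — Σ_{1≤i≤n} 2^{−i} ≤ 1 (and i!(n−i)! ≤ n! inline, `Nat.factorial_mul_factorial_dvd_factorial`);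
  * **`coeff_pow_abs_le`** — b₀ = 0, |b_k| ≤ L·E^k·k! ⟹ |[X^n](mk b)^j| ≤ L^j·(2E)^n·n! for all j, n (induction on j through 33
    `coeff_pow_succ`: the i = 0 term vanishes, and Σ_{i≥1} L E^i i!·L^j (2E)^{n−i}(n−i)! ≤ L^{j+1}(2E)^n n!·Σ_{i≥1} 2^{−i});
  * **`compLetters_abs_le`** — with |c_j| ≤ M∕ρ^j: |ℓ_n| ≤ M·(4E·max(1, L∕ρ))^n·n! (Σ_{j≤n}(L∕ρ)^j ≤ (n+1)·max(1, L∕ρ)^n ≤ (2·max(1, L∕ρ))^n).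
PRESEARCH.  [corpus: book:loday-richaud2016 Prop. 1.2.4 pp. 15–16 (ℂ[[x]]_s is stable under composition — s-Gevrey ∘ s-Gevrey, proved
there via Faà di Bruno's formula [Gev18]); ours is the special case of a CONVERGENT outer series, by the crude majorant Πk_i! ≤ n! with the
number of compositions absorbed into 2^n]; tree: MODULE 28a `abs_coeff_pow_le` is the exp-specific majorant of 31a; no general statement in
Mathlib or the tree.
HONEST.  [folklore] finite-sum majorants; no β-function, no `Conclusions S`; nothing of Bałaban's asserted; NOT B12 Thm 2, NOT BetaPertH,
NOT continuum, NOT Clay.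
HONEST DEPENDENCY: continuum YM on T⁴ ⇐ BetaPertH ∧ nine spine estimates (0/9 proved); BetaPertH ⇐ (D1) ∧ (D4) ∧ CAP+tail;
G-an2-4 gates asym, D1 and NE2/3/4.
-/

noncomputable section

open Finset

open scoped Nat

namespace Summit.QuantumFields.BalabanUV.Beta.EriceFlowEnclosureGevreyCompositionLetters

open Summit.QuantumFields.BalabanUV.Beta.EriceFlowEnclosureGevreyComposition (coeff_pow_succ coeff_pow_zero)

/-! ## §1 A counting fact -/

/-- `Σ_{1≤i≤n} 2^{−i} ≤ 1`, written over `range (n+1)` with the i = 0 term removed by an indicator. [folklore] -/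
theorem sum_half_pow_le_one (n : ℕ) :
    ∑ i ∈ range (n + 1), (if i = 0 then (0 : ℝ) else (1 / 2 : ℝ) ^ i) ≤ 1 := by
  have hgeo : ∀ m : ℕ, ∑ i ∈ range (m + 1), (if i = 0 then (0 : ℝ) else (1 / 2 : ℝ) ^ i) = 1 - (1 / 2 : ℝ) ^ m := by
    intro m
    induction m with
    | zero => simp
    | succ m ih =>
      rw [Finset.sum_range_succ, ih, if_neg (Nat.succ_ne_zero m)]
      ring
  rw [hgeo n]
  have : (0 : ℝ) ≤ (1 / 2 : ℝ) ^ n := by positivity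
  linarith

/-! ## §2 The power letters are Gevrey-1 -/

/-- **THE LETTERS OF A POWER ARE GEVREY-1, geometric in the power**: b₀ = 0 and |b_k| ≤ L·E^k·k! (L ≥ 0, E > 0) give
`|[X^n](mk b)^j| ≤ L^j·(2E)^n·n!` for all j, n — induction on j through MODULE 33 `coeff_pow_succ`; the i = 0 term of the convolution
vanishes (b₀ = 0) and for i ≥ 1, `L E^i i!·L^j (2E)^{n−i}(n−i)! = L^{j+1}(2E)^n·2^{−i}·(i!(n−i)!) ≤ L^{j+1}(2E)^n n!·2^{−i}`, summed by
`Σ_{i≥1} 2^{−i} ≤ 1`. [folklore; Loday-Richaud 2016, Prop. 1.2.4] -/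
theorem coeff_pow_abs_le {b : ℕ → ℝ} {L E : ℝ} (hb0 : b 0 = 0) (hL : 0 ≤ L) (hE : 0 < E)
    (hb : ∀ k, |b k| ≤ L * (E ^ k * k !)) :
    ∀ j n : ℕ, |PowerSeries.coeff n ((PowerSeries.mk b) ^ j)| ≤ L ^ j * ((2 * E) ^ n * n !) := by
  intro j
  induction j with
  | zero =>
    intro n
    rw [coeff_pow_zero]
    split_ifs with h
    · subst h; simp
    · rw [abs_zero]; positivity
  | succ j ih =>
    intro n
    rw [coeff_pow_succ]
    have hterm : ∀ i ∈ range (n + 1), |b i * PowerSeries.coeff (n - i) ((PowerSeries.mk b) ^ j)|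
        ≤ L ^ (j + 1) * ((2 * E) ^ n * n !) * (if i = 0 then (0 : ℝ) else (1 / 2 : ℝ) ^ i) := by
      intro i hi
      have hin : i ≤ n := Nat.lt_succ_iff.mp (Finset.mem_range.mp hi)
      rcases Nat.eq_zero_or_pos i with h0 | hpos
      · subst h0; rw [hb0, zero_mul, abs_zero, if_pos rfl, mul_zero]
      · rw [if_neg hpos.ne', abs_mul]
        have h1 := hb i
        have h2 := ih (n - i)
        have hfac : ((i ! : ℕ) : ℝ) * (((n - i)! : ℕ) : ℝ) ≤ (n ! : ℝ) := by
          have h : ((i ! * (n - i)! : ℕ) : ℝ) ≤ (n ! : ℝ) := by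
            exact_mod_cast Nat.le_of_dvd (Nat.factorial_pos n) (Nat.factorial_mul_factorial_dvd_factorial hin)
          push_cast at h
          exact h
        have hEpow : E ^ i * (2 * E) ^ (n - i) = (2 * E) ^ n * (1 / 2 : ℝ) ^ i := by
          obtain ⟨m, rfl⟩ := Nat.exists_eq_add_of_le hin
          rw [Nat.add_sub_cancel_left, pow_add, mul_pow, mul_pow]
          have h2i : (2 : ℝ) ^ i * (1 / 2 : ℝ) ^ i = 1 := by
            rw [← mul_pow]; norm_num
          calc E ^ i * (2 ^ m * E ^ m) = E ^ i * (2 ^ m * E ^ m) * ((2 : ℝ) ^ i * (1 / 2) ^ i) := by rw [h2i, mul_one]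
            _ = 2 ^ i * E ^ i * (2 ^ m * E ^ m) * (1 / 2) ^ i := by ring
        calc |b i| * |PowerSeries.coeff (n - i) ((PowerSeries.mk b) ^ j)|
            ≤ L * (E ^ i * i !) * (L ^ j * ((2 * E) ^ (n - i) * (n - i)!)) :=
              mul_le_mul h1 h2 (abs_nonneg _) (by positivity)
          _ = L ^ (j + 1) * (E ^ i * (2 * E) ^ (n - i)) * ((i ! : ℝ) * ((n - i)! : ℝ)) := by ring
          _ = L ^ (j + 1) * ((2 * E) ^ n * (1 / 2 : ℝ) ^ i) * ((i ! : ℝ) * ((n - i)! : ℝ)) := by rw [hEpow]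
          _ ≤ L ^ (j + 1) * ((2 * E) ^ n * (1 / 2 : ℝ) ^ i) * (n ! : ℝ) := by
              exact mul_le_mul_of_nonneg_left (by exact_mod_cast hfac) (by positivity)
          _ = L ^ (j + 1) * ((2 * E) ^ n * n !) * (1 / 2 : ℝ) ^ i := by ring
    calc |∑ i ∈ range (n + 1), b i * PowerSeries.coeff (n - i) ((PowerSeries.mk b) ^ j)|
        ≤ ∑ i ∈ range (n + 1), |b i * PowerSeries.coeff (n - i) ((PowerSeries.mk b) ^ j)| := Finset.abs_sum_le_sum_abs _ _
      _ ≤ ∑ i ∈ range (n + 1), L ^ (j + 1) * ((2 * E) ^ n * n !) * (if i = 0 then (0 : ℝ) else (1 / 2 : ℝ) ^ i) :=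
          Finset.sum_le_sum hterm
      _ = L ^ (j + 1) * ((2 * E) ^ n * n !) * ∑ i ∈ range (n + 1), (if i = 0 then (0 : ℝ) else (1 / 2 : ℝ) ^ i) := by
          rw [Finset.mul_sum]
      _ ≤ L ^ (j + 1) * ((2 * E) ^ n * n !) * 1 :=
          mul_le_mul_of_nonneg_left (sum_half_pow_le_one n) (by positivity)
      _ = L ^ (j + 1) * ((2 * E) ^ n * n !) := mul_one _

/-! ## §3 The composition letters are Gevrey-1 -/

/-- **THE LETTERS OF A COMPOSITION ARE GEVREY-1 (no smallness of L∕ρ).**  b₀ = 0, |b_k| ≤ L·E^k·k!, |c_j| ≤ M∕ρ^j (M ≥ 0, ρ > 0) give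
`|Σ_{j≤n} c_j·[X^n](mk b)^j| ≤ M·(4E·max(1, L∕ρ))^n·n!` for every n: `coeff_pow_abs_le` termwise, `Σ_{j≤n}(L∕ρ)^j ≤ (n+1)·max(1, L∕ρ)^n`
and `n + 1 ≤ 2^n`.  With MODULE 33 `gevrey_comp` this makes φ∘g a legitimate FIRST factor for 32l `gevrey_mul` and a legitimate inner
function for a further `gevrey_comp`. [folklore; Loday-Richaud 2016, Prop. 1.2.4] -/
theorem compLetters_abs_le {b c : ℕ → ℝ} {L E M ρ : ℝ} (hb0 : b 0 = 0) (hL : 0 ≤ L) (hE : 0 < E) (hM : 0 ≤ M) (hρ : 0 < ρ)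
    (hb : ∀ k, |b k| ≤ L * (E ^ k * k !)) (hc : ∀ j, |c j| ≤ M / ρ ^ j) (n : ℕ) :
    |∑ j ∈ range (n + 1), c j * PowerSeries.coeff n ((PowerSeries.mk b) ^ j)|
      ≤ M * ((4 * E * max 1 (L / ρ)) ^ n * n !) := by
  set q : ℝ := max 1 (L / ρ) with hq
  have hq1 : 1 ≤ q := le_max_left _ _
  have hq0 : 0 ≤ q := zero_le_one.trans hq1
  have hLq : L / ρ ≤ q := le_max_right _ _
  have hpow := coeff_pow_abs_le hb0 hL hE hb
  have hterm : ∀ j ∈ range (n + 1), |c j * PowerSeries.coeff n ((PowerSeries.mk b) ^ j)|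
      ≤ M * q ^ n * ((2 * E) ^ n * n !) := by
    intro j hj
    have hjn : j ≤ n := Nat.lt_succ_iff.mp (Finset.mem_range.mp hj)
    rw [abs_mul]
    have hρj : 0 < ρ ^ j := pow_pos hρ j
    calc |c j| * |PowerSeries.coeff n ((PowerSeries.mk b) ^ j)|
        ≤ M / ρ ^ j * (L ^ j * ((2 * E) ^ n * n !)) := mul_le_mul (hc j) (hpow j n) (abs_nonneg _) (by positivity)
      _ = M * (L / ρ) ^ j * ((2 * E) ^ n * n !) := by rw [div_pow]; field_simp
      _ ≤ M * q ^ j * ((2 * E) ^ n * n !) := by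
          have : (L / ρ) ^ j ≤ q ^ j := pow_le_pow_left₀ (div_nonneg hL hρ.le) hLq j
          exact mul_le_mul_of_nonneg_right (mul_le_mul_of_nonneg_left this hM) (by positivity)
      _ ≤ M * q ^ n * ((2 * E) ^ n * n !) := by
          have : q ^ j ≤ q ^ n := pow_le_pow_right₀ hq1 hjn
          exact mul_le_mul_of_nonneg_right (mul_le_mul_of_nonneg_left this hM) (by positivity)
  have hN2 : ((n : ℝ) + 1) ≤ 2 ^ n := by
    have h := Nat.lt_two_pow_self (n := n)
    exact_mod_cast h
  calc |∑ j ∈ range (n + 1), c j * PowerSeries.coeff n ((PowerSeries.mk b) ^ j)|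
      ≤ ∑ j ∈ range (n + 1), |c j * PowerSeries.coeff n ((PowerSeries.mk b) ^ j)| := Finset.abs_sum_le_sum_abs _ _
    _ ≤ ∑ j ∈ range (n + 1), M * q ^ n * ((2 * E) ^ n * n !) := Finset.sum_le_sum hterm
    _ = ((n : ℝ) + 1) * (M * q ^ n * ((2 * E) ^ n * n !)) := by
        rw [Finset.sum_const, Finset.card_range, nsmul_eq_mul]; push_cast; ring
    _ ≤ 2 ^ n * (M * q ^ n * ((2 * E) ^ n * n !)) := by gcongr
    _ = M * ((4 * E * q) ^ n * n !) := by
        have h4 : (4 * E * q) ^ n = 2 ^ n * ((2 * E) ^ n * q ^ n) := by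
          rw [mul_pow, mul_pow, show ((4 : ℝ)) ^ n = 2 ^ n * 2 ^ n by rw [← mul_pow]; norm_num]
          ring
        rw [h4]
        ring

end Summit.QuantumFields.BalabanUV.Beta.EriceFlowEnclosureGevreyCompositionLetters
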